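import Summits.BirchSwinnertonDyer.BirchSwinnertonDyer.Theorems.GenusKolyvaginAtTwoTorsionCellSELNegTwistFrame
import HarnessLib

/-!
# SEL (iso-class Selmer pair law), C1-J: the raw rows give Selmer classes of the negative twist (sufficiency in bits)

Crux R″ `RankOneTwoTorsionResidualAtTwo` (stmt-27478), LINE 49 «full_vertex», SUPPORT stub SEL
`IsoClassSelmerPairLawAtTwo`, the `C₁` half (LEAD memo `Cruxes/…/Lines/torsion_cell_full_vertex_SEL_C1_road_g36.md`,
§3, the converse of part C1-F).  Setting of parts C1-F/C1-G (`d = −p₀∏_{q∈Q} q`).  For a pair of units `(U₁, U₂)` whose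
E-class is RELAXED (E's local condition at the primes of `S`), supported on `S ∪ Q ∪ {p₀}`, with `Q`-parity sets
`A₁, A₂ ⊆ Q`, `p₀`-parities `γ₁, γ₂`, and residues/signs of the shape produced by a base pair and the explicit part —
`qr_j(U₁) = c₁ + γ₁[−p₀/j] + qr_j(∏_{A₁} i)` at `j ∈ Q`, `qr_{p₀}(U₁) = ρ₁ + γ₁ + Σ_{i∈A₁}[−p₀/i]`, `sgn U₁ = s₁ + γ₁`
(and similarly for `U₂`) — the RAW ROW SYSTEM (Qa), (Qb), (Pa), (Pb), (∞) of part C1-F in these bits implies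
**`twist_mem_selmerGroup_of_rawRows`**: `c_{E^{(d)}}(U₁, U₂) ∈ Sel⁽²⁾(E^{(d)}/ℚ)` (the `I₀*` relations at `Q ∪ {p₀}` and
the sign condition are exactly the rows; then part C1-G's `twist_mem_selmerGroup_of_frame_negTwist`).

Everything is proved; no LINE 49 statement is restated; BSD is not advanced by this file alone.

## References

* [SilvermanAEC2009] J. H. Silverman, *The Arithmetic of Elliptic Curves*, 2nd ed., Prop. X.1.4, Prop. X.4.9.
* [MazurRubin2010] B. Mazur, K. Rubin, Invent. Math. 181 (2010), Lemma 2.10, Lemma 2.11.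
* [Kane2013SelmerTwists] D. M. Kane, Algebra Number Theory 7 (2013), §2.
-/

noncomputable section

open scoped Classical

namespace Summit.BirchSwinnertonDyer.BirchSwinnertonDyer.Theorems.GenusKolyvaginAtTwo.TorsionCellSEL

open WeierstrassCurve WeierstrassCurve.Affine WeierstrassCurve.Affine.Point
open Literature.NumberTheory.GaloisRepresentations Literature.NumberTheory.EllipticCurves Field
open Literature.NumberTheory.EllipticCurves.TwoDescentLocal
open Literature.NumberTheory.EllipticCurves.KramerTwoDescent
open Literature.NumberTheory.QuadraticForms
open Summit.BirchSwinnertonDyer.BirchSwinnertonDyer.Theorems.GenusKolyvaginAtTwo.TorsionCellD0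
open IsDedekindDomain NumberField Rat.HeightOneSpectrum

variable (E : WeierstrassCurve ℚ) [E.IsElliptic] {e₁ e₂ e₃ : ℚ} (S Q : Finset ℕ) {p₀ : ℕ} [hp₀ : Fact p₀.Prime]

omit hp₀ in
/-- `#(A∖j) + Σ_{i∈A∖j} [−i/j] = |A| + [j∈A] + Σ_{i∈Q∖j} [−i/j]·𝟙_A(i)` for `A ⊆ Q`. [folklore] -/
private theorem card_erase_add_sum_eq {A : Finset ℕ} (hA : A ⊆ Q) (j : ℕ) :
    ((A.erase j).card : ZMod 2) + ∑ i ∈ A.erase j, (if jacobiSym (-(i : ℤ)) j = -1 then (1 : ZMod 2) else 0) =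
      (A.card : ZMod 2) + (if j ∈ A then 1 else 0) +
        ∑ i ∈ Q.erase j, (if jacobiSym (-(i : ℤ)) j = -1 then (1 : ZMod 2) else 0) * (if i ∈ A then 1 else 0) := by
  have hcard : ((A.erase j).card : ZMod 2) = (A.card : ZMod 2) + (if j ∈ A then 1 else 0) := by
    by_cases hjA : j ∈ A
    · rw [if_pos hjA, Finset.card_erase_of_mem hjA]
      have hpos : 0 < A.card := Finset.card_pos.mpr ⟨j, hjA⟩
      have : A.card = (A.card - 1) + 1 := by omega
      conv_rhs => rw [this]
      rw [Nat.cast_add, Nat.cast_one, add_assoc, CharTwo.add_self_eq_zero, add_zero]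
    · rw [if_neg hjA, Finset.erase_eq_of_notMem hjA, add_zero]
  rw [hcard]
  congr 1
  have hset : (Q.erase j).filter (· ∈ A) = A.erase j := by
    ext i; simp only [Finset.mem_filter, Finset.mem_erase]
    constructor
    · rintro ⟨⟨hij, -⟩, hiA⟩; exact ⟨hij, hiA⟩
    · rintro ⟨hij, hiA⟩; exact ⟨⟨hij, hA hiA⟩, hiA⟩
  rw [← hset, Finset.sum_filter]
  refine Finset.sum_congr rfl fun i _ => ?_
  split_ifs <;> simp

/-- **THE RAW ROWS GIVE SELMER CLASSES OF `E^{(−p₀M)}`** (sufficiency, in bits; see the module docstring).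
[cite: SilvermanAEC2009, Prop. X.1.4, Prop. X.4.9] [cite: MazurRubin2010, Lemma 2.10, Lemma 2.11]
[cite: Kane2013SelmerTwists, §2] -/
theorem twist_mem_selmerGroup_of_rawRows (h : E.toAffine.SplitTwoTorsion e₁ e₂ e₃) (h2S : 2 ∈ S)
    (h12 : e₁ < e₂) (h23 : e₂ < e₃)
    (hgood : ∀ ℓ : ℕ, (hℓ : ℓ.Prime) → ℓ ∉ S → haveI : Fact ℓ.Prime := ⟨hℓ⟩;
      padicValRat ℓ (e₁ - e₂) = 0 ∧ padicValRat ℓ (e₁ - e₃) = 0 ∧ padicValRat ℓ (e₂ - e₃) = 0)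
    (hN : ∀ ℓ : ℕ, ℓ.Prime → ℓ ∉ S → ¬ ℓ ∣ E.conductorNorm ℤ)
    (hQ : ∀ q ∈ Q, q.Prime) (hQS : ∀ q ∈ Q, q ∉ S) (hQ4 : ∀ q ∈ Q, q % 4 = 3) (hk : Even Q.card)
    (hiso8 : ∀ q ∈ Q, ∀ q' ∈ Q, q % 8 = q' % 8)
    (hisoS : ∀ q ∈ Q, ∀ q' ∈ Q, ∀ ℓ ∈ S, (hℓ : ℓ.Prime) → ℓ ≠ 2 → haveI : Fact ℓ.Prime := ⟨hℓ⟩;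
      legendreSym ℓ ((q : ℤ) * q') = 1)
    (hadm : ∀ q ∈ Q, (hq : q.Prime) → haveI : Fact q.Prime := ⟨hq⟩;
      qrBit q ((e₁ - e₂) * (e₁ - e₃)) = 1 ∧ qrBit q ((e₂ - e₁) * (e₂ - e₃)) = 1)
    {ε : ZMod 2} (hε : ∀ q ∈ Q, (hq : q.Prime) → haveI : Fact q.Prime := ⟨hq⟩; qrBit q (e₂ - e₁) = ε)
    (hp₀S : p₀ ∉ S) (hp₀Q : p₀ ∉ Q) (hp8 : p₀ % 8 = 7)
    (hsplitp : ∀ ℓ ∈ S, (hℓ : ℓ.Prime) → ℓ ≠ 2 → haveI : Fact ℓ.Prime := ⟨hℓ⟩; legendreSym ℓ (-(p₀ : ℤ)) = 1)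
    (hres₀ : qrBit p₀ (e₂ - e₁) = 0 ∧ qrBit p₀ (e₁ - e₂) = 1 ∧
      qrBit p₀ ((e₁ - e₂) * (e₁ - e₃)) = 0 ∧ qrBit p₀ ((e₂ - e₁) * (e₂ - e₃)) = 1)
    {d : ℚ} (hd : d = -(p₀ : ℚ) * ∏ q ∈ Q, (q : ℚ)) [(E.quadraticTwist d).IsElliptic]
    (U₁ U₂ : ℚˣ) {A₁ A₂ : Finset ℕ} (hA₁ : A₁ ⊆ Q) (hA₂ : A₂ ⊆ Q) {γ₁ γ₂ c₁ c₂ ρ₁ ρ₂ s₁ s₂ : ZMod 2}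
    (hrel : ∀ v : HeightOneSpectrum (𝓞 ℚ), natGenerator v ∈ S →
      E.twoDescentClass h U₁ U₂ ∈ selmerLocalKer E (v.adicCompletion ℚ) 2)
    (hsupp : ∀ ℓ : ℕ, (hℓ : ℓ.Prime) → ℓ ∉ S → ℓ ∉ Q → ℓ ≠ p₀ → haveI : Fact ℓ.Prime := ⟨hℓ⟩;
      parityBit ℓ (U₁ : ℚ) = 0 ∧ parityBit ℓ (U₂ : ℚ) = 0)
    (hbitQ : ∀ j ∈ Q, (hj : j.Prime) → haveI : Fact j.Prime := ⟨hj⟩;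
      parityBit j (U₁ : ℚ) = (if j ∈ A₁ then 1 else 0) ∧ parityBit j (U₂ : ℚ) = (if j ∈ A₂ then 1 else 0) ∧
      qrBit j (U₁ : ℚ) = c₁ + γ₁ * (if jacobiSym (-(p₀ : ℤ)) j = -1 then (1 : ZMod 2) else 0) + qrBit j (∏ i ∈ A₁, (i : ℚ)) ∧
      qrBit j (U₂ : ℚ) = c₂ + γ₂ * (if jacobiSym (-(p₀ : ℤ)) j = -1 then (1 : ZMod 2) else 0) + qrBit j (∏ i ∈ A₂, (i : ℚ)))
    (hbitP : parityBit p₀ (U₁ : ℚ) = γ₁ ∧ parityBit p₀ (U₂ : ℚ) = γ₂ ∧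
      qrBit p₀ (U₁ : ℚ) = ρ₁ + γ₁ + ∑ i ∈ Q, (if jacobiSym (-(p₀ : ℤ)) i = -1 then (1 : ZMod 2) else 0) * (if i ∈ A₁ then 1 else 0) ∧
      qrBit p₀ (U₂ : ℚ) = ρ₂ + γ₂ + ∑ i ∈ Q, (if jacobiSym (-(p₀ : ℤ)) i = -1 then (1 : ZMod 2) else 0) * (if i ∈ A₂ then 1 else 0))
    (hsign : signBit (U₁ : ℚ) = s₁ + γ₁ ∧ signBit (U₂ : ℚ) = s₂ + γ₂)
    (hrows : ∀ j ∈ Q,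
      ((∑ i ∈ Q.erase j, (if jacobiSym (-(i : ℤ)) j = -1 then (1 : ZMod 2) else 0) * (if i ∈ A₁ then 1 else 0)) +
          ((∑ i ∈ Q.erase j, (if jacobiSym (-(i : ℤ)) j = -1 then (1 : ZMod 2) else 0)) +
            (if jacobiSym (-(p₀ : ℤ)) j = -1 then (1 : ZMod 2) else 0) + ε) * (if j ∈ A₁ then 1 else 0) +
          (if j ∈ A₂ then 1 else 0) =
        c₁ + γ₁ * (if jacobiSym (-(p₀ : ℤ)) j = -1 then (1 : ZMod 2) else 0) + (A₁.card : ZMod 2)) ∧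
      ((∑ i ∈ Q.erase j, (if jacobiSym (-(i : ℤ)) j = -1 then (1 : ZMod 2) else 0) * (if i ∈ A₂ then 1 else 0)) +
          ((∑ i ∈ Q.erase j, (if jacobiSym (-(i : ℤ)) j = -1 then (1 : ZMod 2) else 0)) +
            (if jacobiSym (-(p₀ : ℤ)) j = -1 then (1 : ZMod 2) else 0) + ε + 1) * (if j ∈ A₂ then 1 else 0) +
          (if j ∈ A₁ then 1 else 0) =
        c₂ + γ₂ * (if jacobiSym (-(p₀ : ℤ)) j = -1 then (1 : ZMod 2) else 0) + (A₂.card : ZMod 2)))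
    (hPa : ρ₁ + ∑ i ∈ Q, (if jacobiSym (-(p₀ : ℤ)) i = -1 then (1 : ZMod 2) else 0) * (if i ∈ A₁ then 1 else 0) +
      γ₁ * ∑ i ∈ Q, (if jacobiSym (-(p₀ : ℤ)) i = -1 then (1 : ZMod 2) else 0) = 0)
    (hPb : ρ₂ + γ₂ + ∑ i ∈ Q, (if jacobiSym (-(p₀ : ℤ)) i = -1 then (1 : ZMod 2) else 0) * (if i ∈ A₂ then 1 else 0) +
      γ₁ + γ₂ * ∑ i ∈ Q, (if jacobiSym (-(p₀ : ℤ)) i = -1 then (1 : ZMod 2) else 0) = 0)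
    (hinf : s₁ + γ₁ = s₂ + γ₂) :
    (E.quadraticTwist d).twoDescentClass (h.quadraticTwist d) U₁ U₂ ∈ selmerGroup (E.quadraticTwist d) 2 := by
  have hQ0 : ∀ q ∈ Q, (q : ℚ) ≠ 0 := fun q hq => by exact_mod_cast (hQ q hq).ne_zero
  have hP0 : ∏ q ∈ Q, (q : ℚ) ≠ 0 := Finset.prod_ne_zero_iff.mpr hQ0
  have hp0 : (p₀ : ℚ) ≠ 0 := by exact_mod_cast hp₀.out.ne_zero
  have hp4 : p₀ % 4 = 3 := by omega
  refine twist_mem_selmerGroup_of_frame_negTwist E S Q h h2S h12 h23 hgood hN hQ hQS hQ4 hk hiso8 hisoS hp₀S hp₀Q hp8 hsplitp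
    hd U₁ U₂ hsupp hrel (fun q hqp hqT => ?_) (by rw [hsign.1, hsign.2, hinf])
  haveI : Fact q.Prime := ⟨hqp⟩
  rcases hqT with hqQ | hqe
  · -- a row prime `q ∈ Q`
    have hqp₀ : p₀ ≠ q := fun e => hp₀Q (e ▸ hqQ)
    obtain ⟨hδ₁, hδ₂⟩ := hadm q hqQ hqp
    have hεq := hε q hqQ hqp
    have he21 : e₂ - e₁ ≠ 0 := sub_ne_zero.mpr h.ne₁₂.symm
    have hε' : qrBit q (e₁ - e₂) = 1 + ε := by
      rw [← neg_sub, qrBit_neg (p := q) he21, qrBit_neg_one_eq_one_of_emod_four (hQ4 q hqQ), hεq]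
    have hcard : ((Q.erase q).card : ZMod 2) = 1 := by
      rw [Finset.card_erase_of_mem hqQ]
      obtain ⟨r, hr⟩ := hk
      have hpos : 0 < Q.card := Finset.card_pos.mpr ⟨q, hqQ⟩
      have : Q.card - 1 = 2 * (r - 1) + 1 := by omega
      rw [this, Nat.cast_add, Nat.cast_mul, show ((2 : ℕ) : ZMod 2) = 0 by decide, zero_mul, zero_add, Nat.cast_one]
    have hqd : qrBit q d = (if jacobiSym (-(p₀ : ℤ)) q = -1 then (1 : ZMod 2) else 0) +
        (1 + ∑ i ∈ Q.erase q, (if jacobiSym (-(i : ℤ)) q = -1 then (1 : ZMod 2) else 0)) := by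
      rw [hd, qrBit_mul q (neg_ne_zero.mpr hp0) hP0, qrBit_neg_natCast_prime_eq hp₀.out hqp₀,
        qrBit_prod_natCast_eq Q hQ (hQ4 q hqQ) (subset_refl Q), hcard]
    obtain ⟨hpa, hpb, hra, hrb⟩ := hbitQ q hqQ hqp
    obtain ⟨r1, r2⟩ := hrows q hqQ
    have hresA : qrBit q (∏ i ∈ A₁, (i : ℚ)) = (A₁.card : ZMod 2) + (if q ∈ A₁ then 1 else 0) +
        ∑ i ∈ Q.erase q, (if jacobiSym (-(i : ℤ)) q = -1 then (1 : ZMod 2) else 0) * (if i ∈ A₁ then 1 else 0) := by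
      rw [qrBit_prod_natCast_eq Q hQ (hQ4 q hqQ) hA₁, card_erase_add_sum_eq Q hA₁ q]
    have hresB : qrBit q (∏ i ∈ A₂, (i : ℚ)) = (A₂.card : ZMod 2) + (if q ∈ A₂ then 1 else 0) +
        ∑ i ∈ Q.erase q, (if jacobiSym (-(i : ℤ)) q = -1 then (1 : ZMod 2) else 0) * (if i ∈ A₂ then 1 else 0) := by
      rw [qrBit_prod_natCast_eq Q hQ (hQ4 q hqQ) hA₂, card_erase_add_sum_eq Q hA₂ q]
    rw [hpa, hpb, hra, hrb, hresA, hresB, hqd, hεq, hδ₁, hδ₂, hε']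
    constructor
    · linear_combination (norm := (ring_nf; reduce_mod_char)) r1
    · linear_combination (norm := (ring_nf; reduce_mod_char)) r2
  · -- the prime `p₀`
    have hqe' : p₀ = q := hqe.symm
    subst hqe'
    have hqd : qrBit p₀ d = 1 + ∑ i ∈ Q, (if jacobiSym (-(p₀ : ℤ)) i = -1 then (1 : ZMod 2) else 0) := by
      rw [hd, show -(p₀ : ℚ) * ∏ q ∈ Q, (q : ℚ) = (p₀ : ℚ) * (-1 * ∏ q ∈ Q, (q : ℚ)) by ring, qrBit_natCast_mul,
        qrBit_mul p₀ (by norm_num) hP0, qrBit_neg_one_eq_one_of_emod_four hp4,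
        qrBit_prod_natCast Q (fun i hi => (hQ i hi).ne_zero)]
      congr 1
      refine Finset.sum_congr rfl fun i hi => ?_
      exact qrBit_natCast_prime_eq_jacobiBit (hQ i hi) (fun e => hp₀Q (e ▸ hi)) hp4 (hQ4 i hi)
    obtain ⟨hpa, hpb, hra, hrb⟩ := hbitP
    rw [hpa, hpb, hra, hrb, hqd, hres₀.1, hres₀.2.1, hres₀.2.2.1, hres₀.2.2.2]
    constructor
    · linear_combination (norm := (ring_nf; reduce_mod_char)) hPa
    · linear_combination (norm := (ring_nf; reduce_mod_char)) hPb

end Summit.BirchSwinnertonDyer.BirchSwinnertonDyer.Theorems.GenusKolyvaginAtTwo.TorsionCellSEL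

end
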